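import Mathlib.Analysis.SpecialFunctions.Pow.Real
import Mathlib.Algebra.BigOperators.Fin
import HarnessLib

/-!
# Fluctuations of Wilson loops, XV: the hafnian (Wick) functional (gauge-boot, ADDENDUM 33 part A)

HONEST FRAMING (cell `pub-gaugeboot`, page 1 of every file): the venture produces certified bounds
on lattice expectations at stated coupling, gauge group, dimension and torus size; NOT a mass gap,
NOT a continuum limit, NOT a string tension; NOT Yang–Mills-summit-bearing (barriers
`FixedCouplingUltralocality`, `PerturbativeInvisibility`).  Pure algebra: no gauge theory in this file.

## Content

The WICK (hafnian) functional of a kernel `κ : α → α → ℝ` on the entries of a list `Cs` indexed by a finite set `S` of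
positions: `Hf(Cs, ∅) = 1`, `Hf(Cs, S) = Σ_{i ∈ S ∖ a} κ(Cs_a, Cs_i) · Hf(Cs, S ∖ {a, i})` with `a = min S` — the sum over
perfect matchings of `S` of the products of `κ` over matched pairs.  Positions (not erasures) keep the bookkeeping free of
index shifts.  This file: existence (`hafnian_exists`), dependence only on the entries in `S` (`hafnian_congr`), invariance
under monotone relabelling (`hafnian_relabel`, whence the erasure form `hafnian_eraseIdx`), vanishing when an entry is
`κ`-null (`hafnian_eq_zero_of_null`), an exponential bound (`hafnian_bound`), and the peeled form at any minimal element
(`hafnian_peel`).  The slot-Leibniz identity is part B.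

Everything is `[folklore]` (Wick's rule bookkeeping).
-/

noncomputable section

open Finset

namespace Summit.QuantumFields.GaugeBoot

namespace StringDuality

variable {α : Type*}

/-! ## Existence and the peeled form -/

/-- The hafnian functional exists (strong recursion on the position set). [folklore] -/
theorem hafnian_exists (κ : α → α → ℝ) (dflt : α) :
    ∃ Hf : List α → Finset ℕ → ℝ, (∀ Cs : List α, Hf Cs ∅ = 1) ∧
      ∀ (Cs : List α) (S : Finset ℕ) (h : S.Nonempty), Hf Cs S =
        ∑ i ∈ S.erase (S.min' h), κ (Cs.getD (S.min' h) dflt) (Cs.getD i dflt) * Hf Cs ((S.erase (S.min' h)).erase i) := by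
  classical
  have hsub : ∀ (S : Finset ℕ) (h : S.Nonempty) (i : ℕ), (S.erase (S.min' h)).erase i ⊂ S := fun S h i =>
    lt_of_le_of_lt (Finset.erase_subset _ _) (Finset.erase_ssubset (Finset.min'_mem S h))
  have key : ∀ Cs : List α, ∃ f : Finset ℕ → ℝ, f ∅ = 1 ∧ ∀ (S : Finset ℕ) (h : S.Nonempty), f S =
      ∑ i ∈ S.erase (S.min' h), κ (Cs.getD (S.min' h) dflt) (Cs.getD i dflt) * f ((S.erase (S.min' h)).erase i) := by
    intro Cs
    obtain ⟨H, hH⟩ : ∃ H : ∀ s : Finset ℕ, (∀ t : Finset ℕ, t ⊂ s → ℝ) → ℝ, ∀ s rec, H s rec = if h : s.Nonempty then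
        ∑ i ∈ (s.erase (s.min' h)).attach, κ (Cs.getD (s.min' h) dflt) (Cs.getD i dflt) *
          rec ((s.erase (s.min' h)).erase i) (hsub s h i) else 1 := ⟨fun s rec => _, fun _ _ => rfl⟩
    refine ⟨Finset.strongInduction (p := fun _ : Finset ℕ => ℝ) H, ?_, fun S h => ?_⟩
    · rw [Finset.strongInduction_eq, hH, dif_neg (by simp)]
    · rw [Finset.strongInduction_eq, hH, dif_pos h]
      exact Finset.sum_attach (S.erase (S.min' h)) (fun i => κ (Cs.getD (S.min' h) dflt) (Cs.getD i dflt) *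
        Finset.strongInduction (p := fun _ : Finset ℕ => ℝ) H ((S.erase (S.min' h)).erase i))
  choose f hf0 hfS using key
  exact ⟨f, hf0, hfS⟩

section props

variable {κ : α → α → ℝ} {dflt : α} {Hf : List α → Finset ℕ → ℝ} (h0 : ∀ Cs : List α, Hf Cs ∅ = 1)
  (hS : ∀ (Cs : List α) (S : Finset ℕ) (h : S.Nonempty), Hf Cs S =
    ∑ i ∈ S.erase (S.min' h), κ (Cs.getD (S.min' h) dflt) (Cs.getD i dflt) * Hf Cs ((S.erase (S.min' h)).erase i))
include h0 hS

omit h0 in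
/-- The peeled form at any minimal element. [folklore] -/
theorem hafnian_peel (Cs : List α) (S : Finset ℕ) {a : ℕ} (ha : a ∈ S) (hmin : ∀ y ∈ S, a ≤ y) :
    Hf Cs S = ∑ i ∈ S.erase a, κ (Cs.getD a dflt) (Cs.getD i dflt) * Hf Cs ((S.erase a).erase i) := by
  have h : S.Nonempty := ⟨a, ha⟩
  have hm : S.min' h = a := le_antisymm (Finset.min'_le S a ha) (Finset.le_min' S h a hmin)
  rw [hS Cs S h, hm]

/-- The hafnian depends only on the entries at the positions in `S`. [folklore] -/
theorem hafnian_congr : ∀ (S : Finset ℕ) (Cs Cs' : List α), (∀ i ∈ S, Cs.getD i dflt = Cs'.getD i dflt) →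
    Hf Cs S = Hf Cs' S := by
  intro S
  induction S using Finset.strongInduction with
  | H S ih =>
    intro Cs Cs' hagree
    by_cases h : S.Nonempty
    · rw [hS Cs S h, hS Cs' S h]
      refine Finset.sum_congr rfl fun i hi => ?_
      have hi' : i ∈ S := Finset.mem_of_mem_erase hi
      rw [hagree _ (Finset.min'_mem S h), hagree i hi',
        ih _ (lt_of_le_of_lt (Finset.erase_subset _ _) (Finset.erase_ssubset (Finset.min'_mem S h))) Cs Cs'
          (fun k hk => hagree k (Finset.mem_of_mem_erase (Finset.mem_of_mem_erase hk)))]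
    · rw [Finset.not_nonempty_iff_eq_empty.mp h, h0, h0]

/-- Changing an entry outside `S` does not change the hafnian. [folklore] -/
theorem hafnian_set_of_not_mem (S : Finset ℕ) (Cs : List α) {j : ℕ} (hj : j ∉ S) (C' : α) :
    Hf (Cs.set j C') S = Hf Cs S :=
  hafnian_congr h0 hS S _ _ fun i hi => by
    have hij : i ≠ j := fun h => hj (h ▸ hi)
    simp only [List.getD_eq_getElem?_getD, List.getElem?_set_ne hij.symm]

/-- Invariance under strictly monotone relabelling of the positions. [folklore] -/
theorem hafnian_relabel {e : ℕ → ℕ} (he : StrictMono e) : ∀ (T : Finset ℕ) (L Cs : List α),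
    (∀ i ∈ T, L.getD i dflt = Cs.getD (e i) dflt) → Hf L T = Hf Cs (T.image e) := by
  classical
  intro T
  induction T using Finset.strongInduction with
  | H T ih =>
    intro L Cs hget
    by_cases h : T.Nonempty
    · have himg : (T.image e).Nonempty := h.image e
      have hmin : ∀ y ∈ T.image e, e (T.min' h) ≤ y := by
        intro y hy
        obtain ⟨x, hx, rfl⟩ := Finset.mem_image.mp hy
        exact he.monotone (Finset.min'_le T x hx)
      rw [hS L T h, hafnian_peel hS Cs (T.image e) (Finset.mem_image_of_mem e (Finset.min'_mem T h)) hmin,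
        ← Finset.image_erase he.injective, Finset.sum_image fun x _ y _ hxy => he.injective hxy]
      refine Finset.sum_congr rfl fun i hi => ?_
      have hi' : i ∈ T := Finset.mem_of_mem_erase hi
      rw [hget _ (Finset.min'_mem T h), hget i hi', ← Finset.image_erase he.injective]
      congr 1
      exact ih _ (lt_of_le_of_lt (Finset.erase_subset _ _) (Finset.erase_ssubset (Finset.min'_mem T h))) L Cs
        fun k hk => hget k (Finset.mem_of_mem_erase (Finset.mem_of_mem_erase hk))
    · rw [Finset.not_nonempty_iff_eq_empty.mp h, Finset.image_empty, h0, h0]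

/-- Erasure form: the hafnian of `Cs.eraseIdx p` on the first `n` positions is the hafnian of `Cs` on the positions
`{0, …, n} ∖ {p}` (relabel by the map skipping `p`). [folklore] -/
theorem hafnian_eraseIdx (Cs : List α) {p n : ℕ} (hp : p ≤ n) :
    Hf (Cs.eraseIdx p) (Finset.range n) = Hf Cs ((Finset.range (n + 1)).erase p) := by
  classical
  have he : StrictMono (fun i : ℕ => if i < p then i else i + 1) := by
    intro i j hij
    dsimp only
    split_ifs <;> omega
  have himg : (Finset.range n).image (fun i : ℕ => if i < p then i else i + 1) = (Finset.range (n + 1)).erase p := by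
    ext k
    simp only [Finset.mem_image, Finset.mem_range, Finset.mem_erase]
    constructor
    · rintro ⟨i, hi, rfl⟩
      split_ifs <;> omega
    · rintro ⟨hk, hk'⟩
      by_cases hkp : k < p
      · exact ⟨k, by omega, by simp [hkp]⟩
      · exact ⟨k - 1, by omega, by split_ifs <;> omega⟩
  rw [← himg]
  refine hafnian_relabel h0 hS he _ _ _ fun i _ => ?_
  simp only [List.getD_eq_getElem?_getD, List.getElem?_eraseIdx]
  split_ifs <;> rfl

omit h0 in
/-- A `κ`-null entry at a position of `S` kills the hafnian. [folklore] -/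
theorem hafnian_eq_zero_of_null : ∀ (S : Finset ℕ) (Cs : List α),
    (∃ i ∈ S, (∀ X, κ (Cs.getD i dflt) X = 0) ∧ ∀ X, κ X (Cs.getD i dflt) = 0) → Hf Cs S = 0 := by
  intro S
  induction S using Finset.strongInduction with
  | H S ih =>
    intro Cs hex
    obtain ⟨i, hi, hl, hr⟩ := hex
    have h : S.Nonempty := ⟨i, hi⟩
    rw [hS Cs S h]
    refine Finset.sum_eq_zero fun i' hi' => ?_
    by_cases hia : i = S.min' h
    · rw [← hia, hl, zero_mul]
    by_cases hii : i' = i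
    · rw [hii, hr, zero_mul]
    rw [ih _ (lt_of_le_of_lt (Finset.erase_subset _ _) (Finset.erase_ssubset (Finset.min'_mem S h))) Cs
      ⟨i, Finset.mem_erase.mpr ⟨Ne.symm hii, Finset.mem_erase.mpr ⟨hia, hi⟩⟩, hl, hr⟩, mul_zero]

/-- Exponential bound: if `|κ(Cs_i, Cs_j)| ≤ c · w_i · w_j` on `S` (`w ≥ 1`) and `m · c ≤ M`, `1 ≤ M`, then
`|Hf(Cs, S)| ≤ M^{#S} · Π_{i ∈ S} w_i` for `#S ≤ m`. [folklore] -/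
theorem hafnian_bound (Cs : List α) {c M : ℝ} {m : ℕ} {w : ℕ → ℝ} (hc : 0 ≤ c) (hM : 1 ≤ M) (hmc : (m : ℝ) * c ≤ M)
    (hw : ∀ i, 1 ≤ w i) (S₀ : Finset ℕ)
    (hκ : ∀ i ∈ S₀, ∀ j ∈ S₀, |κ (Cs.getD i dflt) (Cs.getD j dflt)| ≤ c * w i * w j) :
    ∀ S : Finset ℕ, S ⊆ S₀ → S.card ≤ m → |Hf Cs S| ≤ M ^ S.card * ∏ i ∈ S, w i := by
  intro S
  induction S using Finset.strongInduction with
  | H S ih =>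
    intro hSS hcard
    by_cases h : S.Nonempty
    · have ha := Finset.min'_mem S h
      set a := S.min' h with haeq
      rw [hS Cs S h]
      have hcardS : S.card = (S.erase a).card + 1 := by rw [Finset.card_erase_of_mem ha]; exact (Nat.sub_add_cancel (Finset.card_pos.mpr h)).symm
      refine (Finset.abs_sum_le_sum_abs _ _).trans ?_
      have hterm : ∀ i ∈ S.erase a, |κ (Cs.getD a dflt) (Cs.getD i dflt) * Hf Cs ((S.erase a).erase i)| ≤
          c * M ^ (S.card - 2) * ∏ k ∈ S, w k := by
        intro i hi
        have hi' : i ∈ S := Finset.mem_of_mem_erase hi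
        have hsub2 : (S.erase a).erase i ⊂ S := lt_of_le_of_lt (Finset.erase_subset _ _) (Finset.erase_ssubset ha)
        have hcard2 : ((S.erase a).erase i).card = S.card - 2 := by
          rw [Finset.card_erase_of_mem hi, Finset.card_erase_of_mem ha]; omega
        rw [abs_mul]
        have h1 := hκ a (hSS ha) i (hSS hi')
        have h2 := ih _ hsub2 (fun k hk => hSS (hsub2.subset hk)) (by rw [hcard2]; omega)
        rw [hcard2] at h2
        have hprod : w a * w i * ∏ k ∈ (S.erase a).erase i, w k = ∏ k ∈ S, w k := by
          rw [mul_assoc, Finset.mul_prod_erase _ _ hi, Finset.mul_prod_erase _ _ ha]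
        calc |κ (Cs.getD a dflt) (Cs.getD i dflt)| * |Hf Cs ((S.erase a).erase i)|
            ≤ (c * w a * w i) * (M ^ (S.card - 2) * ∏ k ∈ (S.erase a).erase i, w k) :=
              mul_le_mul h1 h2 (abs_nonneg _)
                (mul_nonneg (mul_nonneg hc (zero_le_one.trans (hw a))) (zero_le_one.trans (hw i)))
          _ = c * M ^ (S.card - 2) * (w a * w i * ∏ k ∈ (S.erase a).erase i, w k) := by ring
          _ = c * M ^ (S.card - 2) * ∏ k ∈ S, w k := by rw [hprod]
      refine (Finset.sum_le_sum hterm).trans ?_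
      rw [Finset.sum_const, nsmul_eq_mul, Finset.card_erase_of_mem ha]
      have hprodpos : 0 ≤ ∏ k ∈ S, w k := Finset.prod_nonneg fun k _ => zero_le_one.trans (hw k)
      have hcnt : ((S.card - 1 : ℕ) : ℝ) * c ≤ M := by
        refine le_trans ?_ hmc
        exact mul_le_mul_of_nonneg_right (by exact_mod_cast (by omega : S.card - 1 ≤ m)) hc
      have hpow : ((S.card - 1 : ℕ) : ℝ) * c * M ^ (S.card - 2) ≤ M ^ S.card := by
        have hc1 : 1 ≤ S.card := Finset.card_pos.mpr h
        rcases Nat.lt_or_ge S.card 2 with hlt | hge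
        · have : S.card = 1 := by omega
          rw [this]; norm_num; linarith
        · obtain ⟨r, hr⟩ := Nat.exists_eq_add_of_le hge
          rw [hr] at hcnt ⊢
          rw [show 2 + r - 2 = r by omega, pow_add]
          have hMr : 0 ≤ M ^ r := by positivity
          calc ((2 + r - 1 : ℕ) : ℝ) * c * M ^ r ≤ M * M ^ r := mul_le_mul_of_nonneg_right hcnt hMr
            _ = M ^ r * M := by ring
            _ ≤ M ^ r * M ^ 2 := mul_le_mul_of_nonneg_left (by nlinarith [hM]) hMr
            _ = M ^ 2 * M ^ r := by ring
      calc ((S.card - 1 : ℕ) : ℝ) * (c * M ^ (S.card - 2) * ∏ k ∈ S, w k)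
          = (((S.card - 1 : ℕ) : ℝ) * c * M ^ (S.card - 2)) * ∏ k ∈ S, w k := by ring
        _ ≤ M ^ S.card * ∏ k ∈ S, w k := mul_le_mul_of_nonneg_right hpow hprodpos
    · rw [Finset.not_nonempty_iff_eq_empty.mp h, h0]
      simp

end props

end StringDuality

end Summit.QuantumFields.GaugeBoot

end
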